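import Literature.Analysis.FunctionSpaces.LittlewoodPaley
import HarnessLib

/-!
# Discharged facts: dilation invariance of the homogeneous Besov classes

`Literature.Analysis.FunctionSpaces.LittlewoodPaley` records as named facts (`Prop`-valued
`def`s, Bahouri–Chemin–Danchin 2011, Prop. 2.18 and §1.2.1) the behaviour of the Littlewood–Paley
machinery under the dilations `u ↦ u(c ·)` of `𝓢'(E, F)` (`Literature.Analysis.FunctionSpaces.distribDilate`). This file proves
four of them, so users holding the corresponding hypotheses can discharge them:

* `Literature.lpBlock_distribDilate_holds : lpBlock_distribDilate` —
  `Δ̇_j (u(2^{j₀} ·)) = (Δ̇_{j - j₀} u)(2^{j₀} ·)`;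
* `Literature.distribDilate_coe_holds : distribDilate_coe` — for `f ∈ L^p` and `g = f(c ·)` a.e.,
  `distribDilate c f = g` (the duality definition extends the dilation of functions);
* `Literature.eHomBesovNorm_distribDilate_holds : eHomBesovNorm_distribDilate` —
  `‖u(2^{j₀} ·)‖_{Ḃ^s_{p,q}} = 2^{j₀ (s - d/p)} ‖u‖_{Ḃ^s_{p,q}}` (exact equality for dyadic
  dilations, `d = dim E`, `d/∞ = 0`);
* `Literature.MemHomBesov.distribDilate_holds : MemHomBesov.distribDilate` — `u ∈ Ḃ^s_{p,q}` implies
  `u(2^{j₀} ·) ∈ Ḃ^s_{p,q}` (finite norm by the previous item, and the realisation condition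
  `Ṡ_j (u(2^{j₀} ·)) = (Ṡ_{j - j₀} u)(2^{j₀} ·) → 0` as `j → -∞`).

## Proof

The argument is the standard one (BCD, proof of Prop. 2.18: "by the change of variables, the
`L^p` norm of a dilated block is `λ^{-d/p}` times the norm of the block, and dilations permute the
dyadic blocks"), organised as follows.

* Schwartz level (`§ SchwartzDilate`, `§ FourierDilate`): for `a ∈ ℝˣ` and `T_a φ = φ(a ·)`
  (`SchwartzMap.compCLMOfContinuousLinearEquiv` of `ContinuousLinearEquiv.smulLeft a`),
  `𝓕 (T_a φ) = |a|^{-d} T_{a⁻¹} (𝓕 φ)` (`Literature.Analysis.FunctionSpaces.fourier_compSmulLeft`, from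
  `MeasureTheory.Measure.integral_comp_smul`), the same for `𝓕⁻`, and
  `g · T_a ψ = T_a (g(a⁻¹ ·) ψ)` (Mathlib's `SchwartzMap.smulLeftCLM_compCLMOfContinuousLinearEquiv`);
  combined: `T_a (𝓕 (g 𝓕⁻ φ)) = 𝓕 (g(a⁻¹ ·) 𝓕⁻ (T_a φ))`
  (`Literature.Analysis.FunctionSpaces.compSmulLeft_fourier_smulLeftCLM_fourierInv`).
* Distribution level (`§ MultiplierDilate`): by duality
  (`TemperedDistribution.fourierMultiplierCLM_apply_apply`), `g(D) (u(c ·)) = (g(c ·)(D) u)(c ·)`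
  (`Literature.Analysis.FunctionSpaces.fourierMultiplierCLM_distribDilate`); with `χ(2^{-j} 2^{j₀} ξ) = χ(2^{-(j-j₀)} ξ)` this gives
  the block identities for `Ṡ_j` and `Δ̇_j`.
* `L^p` level (`§ LpDilate`): `‖f(c ·)‖_{L^p} = |c|^{-d/p} ‖f‖_{L^p}`
  (`MeasureTheory.Measure.map_addHaar_smul` and `MeasureTheory.eLpNorm_smul_measure_of_ne_zero`),
  `distribDilate_coe` by the change of variables in the pairing, hence
  `‖u(c ·)‖_{L^p} = |c|^{-d/p} ‖u‖_{L^p}` for `Literature.Analysis.FunctionSpaces.eLpNormDistrib` (both sides `∞` off `L^p`, using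
  `distribDilate c⁻¹ ∘ distribDilate c = id`).
* Besov level (`§ BesovDilate`): the weights satisfy
  `2^{js} ‖Δ̇_j (u(2^{j₀} ·))‖_{L^p} = 2^{j₀(s - d/p)} · (2^{(j-j₀)s} ‖Δ̇_{j-j₀} u‖_{L^p})`, and the
  `ℓ^q(ℤ)` norm (Mathlib's `eLpNorm` for `Measure.count`) is homogeneous and shift invariant
  (`MeasureTheory.measurePreserving_sub_right` for the counting measure on `ℤ`).

## References

* H. Bahouri, J.-Y. Chemin, R. Danchin, *Fourier Analysis and Nonlinear Partial Differential
  Equations*, Grundlehren 343, Springer (2011), doi:10.1007/978-3-642-16830-7, §1.2.1 (dilations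
  of `𝓢'`), Def. 2.15, Prop. 2.18 / Rem. 2.19 (homogeneity `‖u(λ ·)‖_{Ḃ^s_{p,r}} ≈ λ^{s - d/p}
  ‖u‖_{Ḃ^s_{p,r}}`, equality for `λ = 2^{j}`). [cite: BahouriCheminDanchin2011, Prop. 2.18]
-/

open MeasureTheory FourierTransform RealInnerProductSpace TemperedDistribution Filter Topology
open scoped SchwartzMap ENNReal NNReal

noncomputable section

namespace Literature.Analysis.FunctionSpaces

/-! ## Dilations of Schwartz functions -/

section SchwartzDilate

variable {V E : Type*} [NormedAddCommGroup V] [NormedSpace ℝ V] [NormedAddCommGroup E]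
  [NormedSpace ℂ E]

/-- The dilation `T_a φ = φ(a ·)` of Schwartz functions by a unit `a ∈ ℝˣ`, realised as Mathlib's
`SchwartzMap.compCLMOfContinuousLinearEquiv ℂ (ContinuousLinearEquiv.smulLeft a)` (written `T_a`
in the docstrings below): `(T_a φ)(x) = φ(a x)` (BCD §1.2.1). [folklore] -/
@[simp]
theorem compSmulLeft_apply (a : ℝˣ) (φ : 𝓢(V, E)) (x : V) :
    SchwartzMap.compCLMOfContinuousLinearEquiv ℂ
      (ContinuousLinearEquiv.smulLeft a : V ≃L[ℝ] V) φ x = φ ((a : ℝ) • x) := rfl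

/-- `T_a T_{a⁻¹} = id` (BCD §1.2.1). [folklore] -/
theorem compSmulLeft_compSmulLeft_inv (a : ℝˣ) (φ : 𝓢(V, E)) :
    SchwartzMap.compCLMOfContinuousLinearEquiv ℂ (ContinuousLinearEquiv.smulLeft a : V ≃L[ℝ] V)
      (SchwartzMap.compCLMOfContinuousLinearEquiv ℂ
        (ContinuousLinearEquiv.smulLeft a⁻¹ : V ≃L[ℝ] V) φ) = φ := by
  ext x
  simp only [compSmulLeft_apply, Units.val_inv_eq_inv_val, inv_smul_smul₀ a.ne_zero]

/-- `T_{a⁻¹} T_a = id` (BCD §1.2.1). [folklore] -/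
theorem compSmulLeft_inv_compSmulLeft (a : ℝˣ) (φ : 𝓢(V, E)) :
    SchwartzMap.compCLMOfContinuousLinearEquiv ℂ (ContinuousLinearEquiv.smulLeft a⁻¹ : V ≃L[ℝ] V)
      (SchwartzMap.compCLMOfContinuousLinearEquiv ℂ
        (ContinuousLinearEquiv.smulLeft a : V ≃L[ℝ] V) φ) = φ := by
  simpa only [inv_inv] using compSmulLeft_compSmulLeft_inv a⁻¹ φ

/-- Multiplication by a temperate function and dilation: `g · (T_a φ) = T_a (g(a⁻¹ ·) · φ)`
(Mathlib's `SchwartzMap.smulLeftCLM_compCLMOfContinuousLinearEquiv`). [folklore] -/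
theorem smulLeftCLM_compSmulLeft {g : V → ℂ} (hg : g.HasTemperateGrowth) (a : ℝˣ)
    (φ : 𝓢(V, E)) :
    SchwartzMap.smulLeftCLM E g (SchwartzMap.compCLMOfContinuousLinearEquiv ℂ
        (ContinuousLinearEquiv.smulLeft a : V ≃L[ℝ] V) φ) =
      SchwartzMap.compCLMOfContinuousLinearEquiv ℂ (ContinuousLinearEquiv.smulLeft a : V ≃L[ℝ] V)
        (SchwartzMap.smulLeftCLM E (fun ξ => g ((a⁻¹ : ℝˣ) • ξ)) φ) := by
  rw [SchwartzMap.smulLeftCLM_compCLMOfContinuousLinearEquiv ℂ hg]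
  rfl

/-- `(u(c ·))(c⁻¹ ·) = u`: dilations of `𝓢'` by `c` and `c⁻¹` are mutually inverse
(BCD §1.2.1). [folklore] -/
theorem distribDilate_inv_distribDilate (c : ℝˣ) (u : 𝓢'(V, E)) :
    distribDilate c⁻¹ (distribDilate c u) = u := by
  ext φ
  simp only [distribDilate_apply_apply, inv_inv, compSmulLeft_inv_compSmulLeft, smul_smul]
  rw [← Complex.ofReal_mul, Units.val_inv_eq_inv_val, abs_inv, inv_inv, ← mul_pow,
    mul_inv_cancel₀ (abs_ne_zero.mpr c.ne_zero), one_pow, Complex.ofReal_one, one_smul]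

/-- `(u(c⁻¹ ·))(c ·) = u` (BCD §1.2.1). [folklore] -/
theorem distribDilate_distribDilate_inv (c : ℝˣ) (u : 𝓢'(V, E)) :
    distribDilate c (distribDilate c⁻¹ u) = u := by
  simpa only [inv_inv] using distribDilate_inv_distribDilate c⁻¹ u

end SchwartzDilate

/-! ## Fourier transform and dilations -/

section FourierDilate

variable {V E : Type*} [NormedAddCommGroup V] [InnerProductSpace ℝ V] [FiniteDimensional ℝ V]
  [MeasurableSpace V] [BorelSpace V] [NormedAddCommGroup E] [NormedSpace ℂ E]

/-- Fourier transform of a dilated function: `𝓕 (f(a ·))(w) = |a|^{-d} (𝓕 f)(a⁻¹ w)`, `a ≠ 0`,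
`d = dim V` (change of variables, `MeasureTheory.Measure.integral_comp_smul`; Mathlib has only the
isometric case `Real.fourier_comp_linearIsometry`). [folklore] -/
theorem fourier_comp_smul (f : V → E) {a : ℝ} (ha : a ≠ 0) (w : V) :
    𝓕 (fun v => f (a • v)) w = |(a ^ Module.finrank ℝ V)⁻¹| • 𝓕 f (a⁻¹ • w) := by
  simp only [Real.fourier_eq]
  have key := Measure.integral_comp_smul (volume : Measure V)
    (fun u : V => 𝐞 (-⟪u, a⁻¹ • w⟫) • f u) a
  simp only [real_inner_smul_left, real_inner_smul_right, inv_mul_cancel_left₀ ha] at key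
  simpa only [real_inner_smul_right] using key

/-- Inverse Fourier transform of a dilated function:
`𝓕⁻ (f(a ·))(w) = |a|^{-d} (𝓕⁻ f)(a⁻¹ w)`. [folklore] -/
theorem fourierInv_comp_smul (f : V → E) {a : ℝ} (ha : a ≠ 0) (w : V) :
    𝓕⁻ (fun v => f (a • v)) w = |(a ^ Module.finrank ℝ V)⁻¹| • 𝓕⁻ f (a⁻¹ • w) := by
  rw [Real.fourierInv_eq_fourier_neg, Real.fourierInv_eq_fourier_neg, fourier_comp_smul f ha,
    smul_neg]

/-- `𝓕 (T_a φ) = |a|^{-d} T_{a⁻¹} (𝓕 φ)` on Schwartz space. [folklore] -/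
theorem fourier_compSmulLeft (a : ℝˣ) (φ : 𝓢(V, E)) :
    𝓕 (SchwartzMap.compCLMOfContinuousLinearEquiv ℂ
        (ContinuousLinearEquiv.smulLeft a : V ≃L[ℝ] V) φ) =
      ((|((a : ℝ) ^ Module.finrank ℝ V)⁻¹| : ℝ) : ℂ) •
        SchwartzMap.compCLMOfContinuousLinearEquiv ℂ
          (ContinuousLinearEquiv.smulLeft a⁻¹ : V ≃L[ℝ] V) (𝓕 φ) := by
  ext w
  rw [smul_apply, Complex.coe_smul, compSmulLeft_apply, SchwartzMap.fourier_coe,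
    SchwartzMap.fourier_coe, Units.val_inv_eq_inv_val]
  exact fourier_comp_smul φ a.ne_zero w

/-- `𝓕⁻ (T_a φ) = |a|^{-d} T_{a⁻¹} (𝓕⁻ φ)` on Schwartz space. [folklore] -/
theorem fourierInv_compSmulLeft (a : ℝˣ) (φ : 𝓢(V, E)) :
    𝓕⁻ (SchwartzMap.compCLMOfContinuousLinearEquiv ℂ
        (ContinuousLinearEquiv.smulLeft a : V ≃L[ℝ] V) φ) =
      ((|((a : ℝ) ^ Module.finrank ℝ V)⁻¹| : ℝ) : ℂ) •
        SchwartzMap.compCLMOfContinuousLinearEquiv ℂ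
          (ContinuousLinearEquiv.smulLeft a⁻¹ : V ≃L[ℝ] V) (𝓕⁻ φ) := by
  ext w
  rw [smul_apply, Complex.coe_smul, compSmulLeft_apply, SchwartzMap.fourierInv_coe,
    SchwartzMap.fourierInv_coe, Units.val_inv_eq_inv_val]
  exact fourierInv_comp_smul φ a.ne_zero w

/-- The absolute Jacobians of `x ↦ a⁻¹ x` and `x ↦ a x` cancel:
`|((a⁻¹)^d)⁻¹| · |(a^d)⁻¹| = 1`. [folklore] -/
theorem abs_inv_pow_inv_mul_abs_pow_inv (a : ℝˣ) (d : ℕ) :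
    |(((a⁻¹ : ℝˣ) : ℝ) ^ d)⁻¹| * |((a : ℝ) ^ d)⁻¹| = 1 := by
  rw [← abs_mul, Units.val_inv_eq_inv_val, inv_pow, inv_inv,
    mul_inv_cancel₀ (pow_ne_zero d a.ne_zero), abs_one]

/-- The key Schwartz-level identity behind `g(D)(u(c ·)) = (g(c ·)(D) u)(c ·)`:
`T_a (𝓕 (g · 𝓕⁻ φ)) = 𝓕 (g(a⁻¹ ·) · 𝓕⁻ (T_a φ))` (the Jacobians `|a|^{∓d}` of `𝓕⁻` and `𝓕`
cancel). [folklore] -/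
theorem compSmulLeft_fourier_smulLeftCLM_fourierInv {g : V → ℂ} (hg : g.HasTemperateGrowth)
    (a : ℝˣ) (φ : 𝓢(V, E)) :
    SchwartzMap.compCLMOfContinuousLinearEquiv ℂ (ContinuousLinearEquiv.smulLeft a : V ≃L[ℝ] V)
        (𝓕 (SchwartzMap.smulLeftCLM E g (𝓕⁻ φ))) =
      𝓕 (SchwartzMap.smulLeftCLM E (fun ξ => g ((a⁻¹ : ℝˣ) • ξ))
        (𝓕⁻ (SchwartzMap.compCLMOfContinuousLinearEquiv ℂ
          (ContinuousLinearEquiv.smulLeft a : V ≃L[ℝ] V) φ))) := by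
  have hg' : (fun ξ => g ((a⁻¹ : ℝˣ) • ξ)).HasTemperateGrowth :=
    hg.comp (ContinuousLinearEquiv.smulLeft (a⁻¹ : ℝˣ) : V ≃L[ℝ] V).toContinuousLinearMap.hasTemperateGrowth
  rw [fourierInv_compSmulLeft, map_smul, smulLeftCLM_compSmulLeft hg',
    FourierTransform.fourier_smul, fourier_compSmulLeft, smul_smul, ← Complex.ofReal_mul,
    mul_comm, abs_inv_pow_inv_mul_abs_pow_inv, Complex.ofReal_one, one_smul, inv_inv]
  congr 4
  funext ξ
  rw [inv_smul_smul]

end FourierDilate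

/-! ## Fourier multipliers and Littlewood–Paley operators commute with dilations -/

section MultiplierDilate

variable {E F : Type*} [NormedAddCommGroup E] [InnerProductSpace ℝ E] [FiniteDimensional ℝ E]
  [MeasurableSpace E] [BorelSpace E] [NormedAddCommGroup F] [NormedSpace ℂ F]

/-- Fourier multipliers and dilations commute up to rescaling the symbol:
`g(D)(u(c ·)) = (g(c ·)(D) u)(c ·)` on `𝓢'(E, F)`, for a symbol `g` of temperate growth and
`c ∈ ℝˣ` (BCD, proof of Prop. 2.18). [folklore] -/
theorem fourierMultiplierCLM_distribDilate {g : E → ℂ} (hg : g.HasTemperateGrowth) (c : ℝˣ)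
    (u : 𝓢'(E, F)) :
    fourierMultiplierCLM F g (distribDilate c u) =
      distribDilate c (fourierMultiplierCLM F (fun ξ => g ((c : ℝ) • ξ)) u) := by
  ext φ
  rw [fourierMultiplierCLM_apply_apply, distribDilate_apply_apply, distribDilate_apply_apply,
    fourierMultiplierCLM_apply_apply, compSmulLeft_fourier_smulLeftCLM_fourierInv hg c⁻¹ φ,
    inv_inv]
  rfl

omit [FiniteDimensional ℝ E] [MeasurableSpace E] [BorelSpace E] in
/-- `χ(2^{-j} 2^{j₀} ξ) = χ(2^{-(j - j₀)} ξ)`: dilation by `2^{j₀}` shifts the low-frequency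
symbols (BCD (2.5)). [folklore] -/
theorem lowFreqSymbol_two_zpow_smul (j j₀ : ℤ) (ξ : E) :
    lowFreqSymbol j (((2 : ℝ) ^ j₀) • ξ) = lowFreqSymbol (j - j₀) ξ := by
  simp only [lowFreqSymbol, smul_smul, ← zpow_add₀ (two_ne_zero' ℝ)]
  rw [show -j + j₀ = -(j - j₀) by ring]

omit [FiniteDimensional ℝ E] [MeasurableSpace E] [BorelSpace E] in
/-- `φ_j(2^{j₀} ξ) = φ_{j - j₀}(ξ)`: dilation by `2^{j₀}` shifts the dyadic symbols
(BCD (2.5)). [folklore] -/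
theorem dyadicSymbol_two_zpow_smul (j j₀ : ℤ) (ξ : E) :
    dyadicSymbol j (((2 : ℝ) ^ j₀) • ξ) = dyadicSymbol (j - j₀) ξ := by
  simp only [dyadicSymbol, smul_smul, ← zpow_add₀ (two_ne_zero' ℝ)]
  rw [show -j + j₀ = -(j - j₀) by ring, show 1 - j + j₀ = 1 - (j - j₀) by ring]

/-- `Ṡ_j (u(2^{j₀} ·)) = (Ṡ_{j - j₀} u)(2^{j₀} ·)`: the low-frequency cut-offs of a dyadically
dilated distribution (BCD, proof of Prop. 2.18). [folklore] -/
theorem lowFreqCutoff_distribDilate (j j₀ : ℤ) (u : 𝓢'(E, F)) :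
    lowFreqCutoff j (distribDilate (Units.mk0 ((2 : ℝ) ^ j₀) (zpow_ne_zero j₀ two_ne_zero)) u) =
      distribDilate (Units.mk0 ((2 : ℝ) ^ j₀) (zpow_ne_zero j₀ two_ne_zero))
        (lowFreqCutoff (j - j₀) u) := by
  rw [lowFreqCutoff_apply, fourierMultiplierCLM_distribDilate (hasTemperateGrowth_lowFreqSymbol j),
    lowFreqCutoff_apply]
  simp only [Units.val_mk0, lowFreqSymbol_two_zpow_smul]

/-- Discharge of the named fact `lpBlock_distribDilate`:
`Δ̇_j (u(2^{j₀} ·)) = (Δ̇_{j - j₀} u)(2^{j₀} ·)` (BCD, proof of Prop. 2.18). [cite: BahouriCheminDanchin2011, Prop. 2.18] -/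
theorem lpBlock_distribDilate_holds : lpBlock_distribDilate (E := E) (F := F) := by
  intro j j₀ u
  rw [lpBlock_apply, fourierMultiplierCLM_distribDilate (hasTemperateGrowth_dyadicSymbol j),
    lpBlock_apply]
  simp only [Units.val_mk0, dyadicSymbol_two_zpow_smul]

end MultiplierDilate

/-! ## `L^p` norms under dilation -/

section LpDilate

variable {E F : Type*} [NormedAddCommGroup E] [InnerProductSpace ℝ E] [FiniteDimensional ℝ E]
  [MeasurableSpace E] [BorelSpace E] [NormedAddCommGroup F] [NormedSpace ℂ F]

omit [NormedSpace ℂ F] in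
/-- Change of variables in `L^p`: `‖f(c ·)‖_{L^p} = |c^d|^{-1/p} ‖f‖_{L^p}` for `c ≠ 0`
(`MeasureTheory.Measure.map_addHaar_smul`; for `p = ∞` the factor is `1` since
`(1/∞).toReal = 0`). [folklore] -/
theorem eLpNorm_comp_smul (p : ℝ≥0∞) (f : E → F) {c : ℝ} (hc : c ≠ 0) :
    eLpNorm (fun x => f (c • x)) p volume =
      ENNReal.ofReal |(c ^ Module.finrank ℝ E)⁻¹| ^ (1 / p).toReal * eLpNorm f p volume := by
  have hemb : MeasurableEmbedding (fun x : E => c • x) :=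
    (Homeomorph.smul (Units.mk0 c hc)).measurableEmbedding
  have h0 : ENNReal.ofReal |(c ^ Module.finrank ℝ E)⁻¹| ≠ 0 :=
    (ENNReal.ofReal_pos.2 (abs_pos.2 (inv_ne_zero (pow_ne_zero _ hc)))).ne'
  rw [← Function.comp_def f, ← hemb.eLpNorm_map_measure, Measure.map_addHaar_smul volume hc,
    eLpNorm_smul_measure_of_ne_zero h0, smul_eq_mul]

omit [NormedSpace ℂ F] in
/-- `f ∈ L^p ⇒ f(c ·) ∈ L^p` for `c ∈ ℝˣ` (change of variables). [folklore] -/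
theorem memLp_comp_smul {p : ℝ≥0∞} (f : Lp F p (volume : Measure E)) (c : ℝˣ) :
    MemLp (fun x => (f : E → F) ((c : ℝ) • x)) p volume := by
  have h1 : MemLp (f : E → F) p (Measure.map (fun x : E => (c : ℝ) • x) volume) := by
    rw [Measure.map_addHaar_smul volume c.ne_zero]
    exact (Lp.memLp f).smul_measure ENNReal.ofReal_ne_top
  exact h1.comp_of_map (measurable_const_smul _).aemeasurable

variable [CompleteSpace F]

/-- Discharge of the named fact `distribDilate_coe`: the dilation of distributions extends the
dilation of `L^p` functions, `distribDilate c f = f(c ·)` for `f ∈ L^p` (change of variables in the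
pairing `∫ φ(c⁻¹ x) f(x) dx`; BCD §1.2.1). [cite: BahouriCheminDanchin2011, §1.2.1] -/
theorem distribDilate_coe_holds : distribDilate_coe (E := E) (F := F) := by
  intro p _ c f g hfg
  ext φ
  have hR : (g : 𝓢'(E, F)) φ = ∫ x, φ x • (f : E → F) ((c : ℝ) • x) := by
    rw [Lp.toTemperedDistribution_apply]
    exact integral_congr_ae (hfg.mono fun x hx => by simp [hx])
  rw [hR, distribDilate_apply_apply, Lp.toTemperedDistribution_apply, Complex.coe_smul]
  have key := Measure.integral_comp_smul (volume : Measure E)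
    (fun y : E =>
      SchwartzMap.compCLMOfContinuousLinearEquiv ℂ
        (ContinuousLinearEquiv.smulLeft c⁻¹ : E ≃L[ℝ] E) φ y • (f : E → F) y) c
  simp only [compSmulLeft_apply, Units.val_inv_eq_inv_val, inv_smul_smul₀ c.ne_zero] at key
  rw [key, abs_inv, abs_pow, inv_pow]
  simp only [compSmulLeft_apply, Units.val_inv_eq_inv_val]

/-- `‖u(c ·)‖_{L^p} = |c^d|^{-1/p} ‖u‖_{L^p}` for tempered distributions and `Literature.Analysis.FunctionSpaces.eLpNormDistrib`
(both sides are `∞` when `u ∉ L^p`, because `u ∈ L^p ↔ u(c ·) ∈ L^p`; BCD, proof of Prop. 2.18). [folklore] -/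
theorem eLpNormDistrib_distribDilate {p : ℝ≥0∞} [Fact (1 ≤ p)] (c : ℝˣ) (u : 𝓢'(E, F)) :
    eLpNormDistrib p (distribDilate c u) =
      ENNReal.ofReal |((c : ℝ) ^ Module.finrank ℝ E)⁻¹| ^ (1 / p).toReal * eLpNormDistrib p u := by
  by_cases hu : ∃ f : Lp F p (volume : Measure E), (f : 𝓢'(E, F)) = u
  · obtain ⟨f, rfl⟩ := hu
    have hg := memLp_comp_smul f c
    rw [distribDilate_coe_holds c f (hg.toLp _) (MemLp.coeFn_toLp hg), eLpNormDistrib_coe,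
      eLpNormDistrib_coe, Lp.enorm_def, Lp.enorm_def, eLpNorm_congr_ae (MemLp.coeFn_toLp hg),
      eLpNorm_comp_smul p _ c.ne_zero]
  · push Not at hu
    have hu' : ∀ g : Lp F p (volume : Measure E), (g : 𝓢'(E, F)) ≠ distribDilate c u := by
      intro g hg
      have hg' := memLp_comp_smul g c⁻¹
      apply hu (hg'.toLp _)
      rw [← distribDilate_coe_holds c⁻¹ g (hg'.toLp _) (MemLp.coeFn_toLp hg'), hg,
        distribDilate_inv_distribDilate]
    have h0 : ENNReal.ofReal |((c : ℝ) ^ Module.finrank ℝ E)⁻¹| ^ (1 / p).toReal ≠ 0 :=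
      (ENNReal.rpow_pos (ENNReal.ofReal_pos.2 (abs_pos.2 (inv_ne_zero (pow_ne_zero _ c.ne_zero))))
        ENNReal.ofReal_ne_top).ne'
    rw [eLpNormDistrib_of_forall_ne hu, eLpNormDistrib_of_forall_ne hu', ENNReal.mul_top h0]

end LpDilate

/-! ## Dyadic scaling of the homogeneous Besov norm -/

section BesovDilate

/-- Homogeneity of Mathlib's `eLpNorm` for `ℝ≥0∞`-valued functions: `‖C w‖_{L^q} = C ‖w‖_{L^q}`
for a constant `0 < C < ∞` (Mathlib has `eLpNorm_const_smul` only for normed scalars). [folklore] -/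
theorem eLpNorm_const_mul_ennreal {α : Type*} [MeasurableSpace α] (μ : Measure α) (q : ℝ≥0∞)
    {C : ℝ≥0∞} (hC₀ : C ≠ 0) (hC : C ≠ ∞) {w : α → ℝ≥0∞} (hw : AEStronglyMeasurable w μ) :
    eLpNorm (fun x => C * w x) q μ = C * eLpNorm w q μ := by
  apply le_antisymm
  · exact eLpNorm_le_mul_eLpNorm_of_ae_le_mul'' q hw (ae_of_all _ fun x => by simp)
  · have hCw : AEStronglyMeasurable (fun x => C * w x) μ :=
      (ENNReal.continuous_const_mul hC).comp_aestronglyMeasurable hw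
    have h := eLpNorm_le_mul_eLpNorm_of_ae_le_mul'' (f := w) (c := C⁻¹) (g := fun x => C * w x) q
      hCw (ae_of_all _ fun x => by simp [← mul_assoc, ENNReal.inv_mul_cancel hC₀ hC])
    calc C * eLpNorm w q μ ≤ C * (C⁻¹ * eLpNorm (fun x => C * w x) q μ) := mul_le_mul_right h C
      _ = eLpNorm (fun x => C * w x) q μ := by
        rw [← mul_assoc, ENNReal.mul_inv_cancel hC₀ hC, one_mul]

/-- The `L^p` dilation constant of `x ↦ 2^{j₀} x` in `ℝ≥0∞` exponent form:
`|((2^{j₀})^d)⁻¹|^{1/p} = 2^{-j₀ d / p}` (with `1/∞ = 0`). [folklore] -/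
theorem dilateConst_two_zpow (j₀ : ℤ) (d : ℕ) (p : ℝ≥0∞) :
    ENNReal.ofReal |(((2 : ℝ) ^ j₀) ^ d)⁻¹| ^ (1 / p).toReal =
      (2 : ℝ≥0∞) ^ (-((j₀ : ℝ) * d) / p.toReal) := by
  have h2 : (0 : ℝ) < 2 := two_pos
  have hx : (0 : ℝ) < ((2 : ℝ) ^ j₀) ^ d := pow_pos (zpow_pos h2 _) _
  rw [abs_of_pos (inv_pos.2 hx), ← Real.rpow_intCast, ← Real.rpow_natCast,
    ← Real.rpow_mul h2.le, ← Real.rpow_neg h2.le, ← ENNReal.ofReal_rpow_of_pos h2,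
    ENNReal.ofReal_ofNat, ← ENNReal.rpow_mul, one_div, ENNReal.toReal_inv, div_eq_mul_inv]

variable {E F : Type*} [NormedAddCommGroup E] [InnerProductSpace ℝ E] [FiniteDimensional ℝ E]
  [MeasurableSpace E] [BorelSpace E] [NormedAddCommGroup F] [NormedSpace ℂ F] [CompleteSpace F]

/-- The dyadic pieces of a dilated distribution:
`2^{js} ‖Δ̇_j (u(2^{j₀} ·))‖_{L^p} = 2^{j₀ (s - d/p)} · 2^{(j - j₀) s} ‖Δ̇_{j - j₀} u‖_{L^p}`
(BCD, proof of Prop. 2.18). [folklore] -/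
theorem lpBlockWeight_distribDilate (s : ℝ) (p : ℝ≥0∞) [Fact (1 ≤ p)] (j₀ : ℤ) (u : 𝓢'(E, F))
    (j : ℤ) :
    lpBlockWeight s p (distribDilate (Units.mk0 ((2 : ℝ) ^ j₀) (zpow_ne_zero j₀ two_ne_zero)) u) j =
      (2 : ℝ≥0∞) ^ ((j₀ : ℝ) * (s - Module.finrank ℝ E / p.toReal)) *
        lpBlockWeight s p u (j - j₀) := by
  simp only [lpBlockWeight]
  rw [lpBlock_distribDilate_holds j j₀ u, eLpNormDistrib_distribDilate, Units.val_mk0,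
    dilateConst_two_zpow, ← mul_assoc, ← mul_assoc,
    ← ENNReal.rpow_add _ _ two_ne_zero ENNReal.ofNat_ne_top,
    ← ENNReal.rpow_add _ _ two_ne_zero ENNReal.ofNat_ne_top]
  congr 2
  push_cast
  ring

/-- Discharge of the named fact `eHomBesovNorm_distribDilate` (BCD Prop. 2.18 / Rem. 2.19):
`‖u(2^{j₀} ·)‖_{Ḃ^s_{p,q}} = 2^{j₀ (s - d/p)} ‖u‖_{Ḃ^s_{p,q}}` for every `u ∈ 𝓢'(E, F)`, `s ∈ ℝ`,
`1 ≤ p ≤ ∞`, `q ∈ [0, ∞]`, `j₀ ∈ ℤ`. [cite: BahouriCheminDanchin2011, Prop. 2.18] -/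
theorem eHomBesovNorm_distribDilate_holds : eHomBesovNorm_distribDilate (E := E) (F := F) := by
  intro s p q _ j₀ u
  have hw : lpBlockWeight s p
      (distribDilate (Units.mk0 ((2 : ℝ) ^ j₀) (zpow_ne_zero j₀ two_ne_zero)) u) =
      fun j => (2 : ℝ≥0∞) ^ ((j₀ : ℝ) * (s - Module.finrank ℝ E / p.toReal)) *
        lpBlockWeight s p u (j - j₀) :=
    funext (lpBlockWeight_distribDilate s p j₀ u)
  have hC₀ : (2 : ℝ≥0∞) ^ ((j₀ : ℝ) * (s - Module.finrank ℝ E / p.toReal)) ≠ 0 := by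
    simp [ENNReal.rpow_eq_zero_iff]
  have hC : (2 : ℝ≥0∞) ^ ((j₀ : ℝ) * (s - Module.finrank ℝ E / p.toReal)) ≠ ∞ :=
    ENNReal.rpow_ne_top_of_ne_zero two_ne_zero ENNReal.ofNat_ne_top
  unfold eHomBesovNorm
  rw [hw]
  rw [eLpNorm_const_mul_ennreal Measure.count q hC₀ hC
    StronglyMeasurable.of_discrete.aestronglyMeasurable]
  congr 1
  exact eLpNorm_comp_measurePreserving (g := lpBlockWeight s p u)
    StronglyMeasurable.of_discrete.aestronglyMeasurable (measurePreserving_sub_right _ j₀)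

/-- Discharge of the named fact `MemHomBesov.distribDilate` (BCD Prop. 2.18): `Ḃ^s_{p,q}` is
invariant under the dyadic dilations `u ↦ u(2^{j₀} ·)` — finite norm by
`eHomBesovNorm_distribDilate_holds`, realisation condition `Ṡ_j (u(2^{j₀} ·)) → 0` by
`lowFreqCutoff_distribDilate` and the continuity of `distribDilate`. [cite: BahouriCheminDanchin2011, Prop. 2.18] -/
theorem MemHomBesov.distribDilate_holds : MemHomBesov.distribDilate (E := E) (F := F) := by
  intro s p q _ u h j₀
  refine ⟨?_, ?_⟩
  · rw [eHomBesovNorm_distribDilate_holds s p q j₀ u]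
    exact ENNReal.mul_lt_top
      (lt_top_iff_ne_top.2 (ENNReal.rpow_ne_top_of_ne_zero two_ne_zero ENNReal.ofNat_ne_top)) h.1
  · have hcont := (Literature.Analysis.FunctionSpaces.distribDilate (E := E) (F := F)
      (Units.mk0 ((2 : ℝ) ^ j₀) (zpow_ne_zero j₀ two_ne_zero))).continuous.tendsto (0 : 𝓢'(E, F))
    rw [map_zero] at hcont
    have hshift : Tendsto (fun j : ℤ => j - j₀) atBot atBot :=
      tendsto_atBot_atBot.2 fun b => ⟨b + j₀, fun a ha => by omega⟩
    refine (hcont.comp (h.2.comp hshift)).congr fun j => ?_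
    simp only [Function.comp_apply]
    exact (lowFreqCutoff_distribDilate j j₀ u).symm

end BesovDilate

end Literature.Analysis.FunctionSpaces
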